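import Summits.CriticalPhenomena.SAWScalingLimit.Theses.SAWTotalPositivity

/-!
# Negative-side file for the crux `SAWTotalPositivity.TPToTraversalBound` (stmt-CriticalPhenomena-10687):
POSITIVE AUDIT — the sketch lemma `OptionalStoppingLR` (ideator 2, card `target-switching-smlr`) holds verbatim

Refuter `cdisprove` (standing adversary, cycle 3); work file
`Summits/CriticalPhenomena/SAWScalingLimit/Cruxes/TPToTraversalBound/Disproof.lean` §8.
`PrefixSet` is a VERBATIM copy from `Cruxes/TPToTraversalBound/SketchIdeator2.lean` (crux work files cannot be imported
here) and `optionalStoppingLR` has verbatim the binders/conclusion of `Sketch.OptionalStoppingLR` — finite additivity of the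
critical SAW measure over the stopped (pairwise disjoint) prefix family, the hypothesis summed over the family, a
swap of the two finite sums, additivity again for each alternative target, monotonicity.  Holds for every
`Ω ⊆ ℂ` (bounded or not), every mesh and every `r ∈ ℝ≥0∞` including `⊤`: no junk, the bookkeeping step of the
SMLR line is free.
-/

namespace Summit.CriticalPhenomena.SAWScalingLimit.Theorems.TPToTraversalBound.Negative

open scoped BigOperators ENNReal
open MeasureTheory Literature.Probability.LatticeModels
open Literature.Probability.RandomPlanarGeometry


/-- Verbatim copy of `Sketch.PrefixSet` (ideator 2, Cruxes/TPToTraversalBound/SketchIdeator2.lean): the set of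
SAW chords `a → b` of `Ω_δ` that extend a given lattice prefix `η : a → v`. -/
def PrefixSet (Ω : Set ℂ) (δ : ℝ) (a b : Site 2) {v : Site 2}
    (η : (discreteDomainGraph Ω δ).Walk a v) : Set (SAW.DomainSAW Ω δ a b) :=
  {γ | ∃ q : (discreteDomainGraph Ω δ).Walk v b, γ.walk = η.append q}

/-- CERTIFIED (positive audit of a sketch lemma): `Sketch.OptionalStoppingLR` (ideator 2, card `target-switching-smlr`;
its binders and conclusion are reproduced VERBATIM as the hypotheses and goal of this theorem, so
`fun Ω δ a b J S r => optionalStoppingLR Ω δ a b J S r` inhabits the sketch `Prop`) holds — for every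
`Ω ⊆ ℂ` (bounded or not), every mesh, every `r ∈ ℝ≥0∞` including `⊤`.  Proof: finite additivity of the
critical SAW measure over the stopped (pairwise disjoint) prefix family, the hypothesis summed over the family,
a swap of the two finite sums, additivity again for each alternative target, and monotonicity.  No junk: the
lemma is pure measure bookkeeping (discrete σ-algebra), so the SMLR line may use it freely. [folklore] -/
theorem optionalStoppingLR (Ω : Set ℂ) (δ : ℝ) (a b : Site 2) (J : Finset (Site 2))
    (S : Finset (Σ v : Site 2, (discreteDomainGraph Ω δ).Walk a v)) (r : ℝ≥0∞)
    (hdisj : ∀ c : Site 2, (S : Set (Σ v : Site 2, (discreteDomainGraph Ω δ).Walk a v)).PairwiseDisjoint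
        fun η => PrefixSet Ω δ a c η.2)
    (hη : ∀ η ∈ S, r * SAW.weight Ω δ a b (PrefixSet Ω δ a b η.2)
        ≤ ∑ c ∈ J, SAW.weight Ω δ a c (PrefixSet Ω δ a c η.2)) :
    r * SAW.weight Ω δ a b (⋃ η ∈ S, PrefixSet Ω δ a b η.2)
      ≤ ∑ c ∈ J, SAW.weight Ω δ a c Set.univ := by
  classical
  have hmeas : ∀ (c : Site 2) (η : Σ v : Site 2, (discreteDomainGraph Ω δ).Walk a v),
      MeasurableSet (PrefixSet Ω δ a c η.2) := fun _ _ => MeasurableSpace.measurableSet_top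
  calc r * SAW.weight Ω δ a b (⋃ η ∈ S, PrefixSet Ω δ a b η.2)
      = r * ∑ η ∈ S, SAW.weight Ω δ a b (PrefixSet Ω δ a b η.2) := by
        rw [measure_biUnion_finset (hdisj b) (fun η _ => hmeas b η)]
    _ = ∑ η ∈ S, r * SAW.weight Ω δ a b (PrefixSet Ω δ a b η.2) := Finset.mul_sum _ _ _
    _ ≤ ∑ η ∈ S, ∑ c ∈ J, SAW.weight Ω δ a c (PrefixSet Ω δ a c η.2) := Finset.sum_le_sum hη
    _ = ∑ c ∈ J, ∑ η ∈ S, SAW.weight Ω δ a c (PrefixSet Ω δ a c η.2) := Finset.sum_comm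
    _ = ∑ c ∈ J, SAW.weight Ω δ a c (⋃ η ∈ S, PrefixSet Ω δ a c η.2) := by
        refine Finset.sum_congr rfl fun c _ => ?_
        rw [measure_biUnion_finset (hdisj c) (fun η _ => hmeas c η)]
    _ ≤ ∑ c ∈ J, SAW.weight Ω δ a c Set.univ :=
        Finset.sum_le_sum fun c _ => measure_mono (Set.subset_univ _)


end Summit.CriticalPhenomena.SAWScalingLimit.Theorems.TPToTraversalBound.Negative
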